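import Summits.KontsevichZagierPeriods.Zeta5Search.LaiSweepShard

/-!
# `κ₃` sweep certificate — shard file 125 of 127 (shards 875–881 of 889)

HONEST FRAMING. Systematic search; no irrationality claim unless certified. This file only checks,
by `decide +kernel`, shards 875–881 of the order-cell sweep of the `κ₃` point `(74, 2180, 444; δ74)`
(engine `LaiSweepEngine`, soundness `LaiSweepJump/Free/Eval/Shard/Kappa3`; a shard is `⟨regime, n,
p, q, p', q', Lo, Up⟩`: `n` cells from `p/q` to `p'/q'` with integer rate sums in `[Lo, Up]`, `K =
128`, `D = 2^40`). It draws NO conclusion: only the capstone `LaiKappa3SweepCert`, which needs all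
127 shard files, does. Kernel cost of this file ≈ 560 cells × 0.3 s.
-/

namespace Summit.KontsevichZagierPeriods.Zeta5Search.Sweep

set_option maxHeartbeats 100000000 in
/-- Shard 875: 80 cells of regime B from `343/349` to `429/436`.
[cite: Lai2024BallRivoal, §4 Lemma 4.3] -/
theorem shard875 :
    Shard.check 128 (2^40)
      ⟨true, 80, 343, 349, 429, 436, 9049446681764, 16362695246589⟩ = true := by
  decide +kernel

set_option maxHeartbeats 100000000 in
/-- Shard 876: 80 cells of regime B from `429/436` to `67/68`.
[cite: Lai2024BallRivoal, §4 Lemma 4.3] -/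
theorem shard876 :
    Shard.check 128 (2^40)
      ⟨true, 80, 429, 436, 67, 68, 10726801817674, 19415041525006⟩ = true := by
  decide +kernel

set_option maxHeartbeats 100000000 in
/-- Shard 877: 80 cells of regime B from `67/68` to `367/372`.
[cite: Lai2024BallRivoal, §4 Lemma 4.3] -/
theorem shard877 :
    Shard.check 128 (2^40)
      ⟨true, 80, 67, 68, 367, 372, 10048755372204, 18206952815576⟩ = true := by
  decide +kernel

set_option maxHeartbeats 100000000 in
/-- Shard 878: 80 cells of regime B from `367/372` to `404/409`.
[cite: Lai2024BallRivoal, §4 Lemma 4.3] -/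
theorem shard878 :
    Shard.check 128 (2^40)
      ⟨true, 80, 367, 372, 404, 409, 9651151116875, 17504024970310⟩ = true := by
  decide +kernel

set_option maxHeartbeats 100000000 in
/-- Shard 879: 80 cells of regime B from `404/409` to `357/361`.
[cite: Lai2024BallRivoal, §4 Lemma 4.3] -/
theorem shard879 :
    Shard.check 128 (2^40)
      ⟨true, 80, 404, 409, 357, 361, 9084589121908, 16492117612181⟩ = true := by
  decide +kernel

set_option maxHeartbeats 100000000 in
/-- Shard 880: 80 cells of regime B from `357/361` to `304/307`.
[cite: Lai2024BallRivoal, §4 Lemma 4.3] -/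
theorem shard880 :
    Shard.check 128 (2^40)
      ⟨true, 80, 357, 361, 304, 307, 10373471156620, 18850543659965⟩ = true := by
  decide +kernel

set_option maxHeartbeats 100000000 in
/-- Shard 881: 80 cells of regime B from `304/307` to `4763/4804`.
[cite: Lai2024BallRivoal, §4 Lemma 4.3] -/
theorem shard881 :
    Shard.check 128 (2^40)
      ⟨true, 80, 304, 307, 4763, 4804, 9814033181572, 17852195900603⟩ = true := by
  decide +kernel

/-- The checked shards of this file, in order. [folklore] -/
def shards125 : List (CheckedShard 128 (2^40)) :=
  [⟨_, shard875⟩, ⟨_, shard876⟩, ⟨_, shard877⟩, ⟨_, shard878⟩, ⟨_, shard879⟩,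
    ⟨_, shard880⟩, ⟨_, shard881⟩]

end Summit.KontsevichZagierPeriods.Zeta5Search.Sweep
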